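import Literature.Topology.FourManifolds.LefschetzHandlebody
import Literature.Geometry.Symplectic.PlanarContactBoundary
import HarnessLib

/-!
# Baykur's Stein realisation of a sorted one-sided Lefschetz model (named fact)

Topic `Literature/Geometry/Symplectic`; namespace `Literature.Geometry.Symplectic`.  One NAMED FACT
(D-0014; `def … : Prop`, nothing proved) over the Lefschetz-handlebody vocabulary of
`Literature/Topology/FourManifolds/LefschetzHandlebody.lean` (`ModelsOn`, `IsLefschetzHandlebody`)
and the tree's Stein / open-book vocabulary (`SteinStructure`, `boundaryPlaneField`, `OpenBook`,
`OpenBook.IsGirouxForm`, `wedge₁₂`, `IsBoundaryGluing`).  Consumer: crux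
`ConvexBisection.AcyclicBisectionExists` (stmt-SmoothPoincare4-10508), line `modp-braid-orbits`
(the realisation clause of `stub_sortedModelOfHandleSplitting`).

## Source (held text, read 2026-08-16)

R. İ. Baykur, *Kähler decomposition of 4-manifolds*, Algebr. Geom. Topol. 6 (2006) 1239–1265,
arXiv:math/0601396, proof of Thm. 5.1, pp. 12–14 (arXiv pagination), for a closed-up achiral
Lefschetz fibration whose Hurwitz word is SORTED (positive letters `P` first, then negative letters
`N`): *"we get a disk enclosing only positive critical points … `μ₊` defines a positive Lefschetz
fibration on `X₊` and `μ₋` defines a negative fibration on `X₋`. To recover the original 4-manifold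
`X` we need to put back in `S¹ × D³`, which has the same effect as gluing each other the tubular
neighborhoods `S¹ × D₊²` and `S¹ × D₋²` of the bindings of open books on `∂X₊` and `∂X₋` …
Therefore we can think of `X` as decomposing into `X₊` and `X₋` … Noting that the NALF on `X₋`
becomes a PALF on `−X₋`, we see that both PALFs induce the same open book decomposition on their
boundaries"* (p. 13); *"By [LP, AO], both `X₊` and `−X₋` admit Stein structures. We will construct
these Stein structures using Eliashberg's characterization so that they match on the common
boundary. … The PALF on `X₊` is obtained by attaching positive Lefschetz handles `h₁, …, h_m` to
`X₀ = F × D²` … As `C` is non-separating … the Lefschetz handle `hᵢ` is attached along a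
Legendrian curve with framing `tb − 1`. By Eliashberg the Stein structure extends over this handle,
and as shown by Gay [Ga], the new open book on `∂Xᵢ` will be compatible with the new induced
contact structure on `∂Xᵢ` … the compatible open books on `∂X₊` and `∂(−X₋)` are isotopic, and
therefore the induced contact structures `ξ₊` on `∂X₊` and `ξ₋` on `∂(−X₋) = −∂X₋` are isotopic
as well"* (p. 14).  Inputs quoted there: Loi–Piergallini 2001 / Akbulut–Ozbagci 2001, Thm. 5
(PALF ⇒ Stein), Eliashberg 1990 (Legendrian surgery), Gay 2006 (compatibility of the new open
book), Giroux 2002 (contact structures supported by one open book are isotopic).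

## The Lean rendering

`steinRealisation_of_sorted_modelsOnFibred`: if the `C^∞` 4-manifold `M` has a FIBRED model
`ModelsOnFibred M g (P ++ N)` (`M ∖ S¹ × D³` an achiral Lefschetz fibration over `S²` with Hurwitz
word `P ++ N`; the fibration is what Baykur's proof splits along `D₊ ∪ D₋` — the weak handlebody
model `ModelsOn`, which forgets the seam open-book matching, would not suffice) with `P` positive, `N` negative and all classes non-zero (allowable), then `M` is a
boundary gluing `W₁ ∪_φ W₂` (`IsBoundaryGluing`) of two compact `C^∞` 4-manifolds with boundary
carrying Stein structures `S₁`, `S₂`, where `W₁` IS the Lefschetz handlebody `X(F; P)`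
(`IsLefschetzHandlebody g P W₁` — print's `X₊ = PALF(F; P)`; `W₂` is print's `−X₋`), and ONE open
book `ob` on `∂W₁` supports both the `S₁`-induced boundary plane field and the pull-back along `φ`
of the `S₂`-induced one, through Giroux forms `α₁`, `α₂` inducing the same orientation (print:
"both PALFs induce the same open book decomposition on their boundaries … compatible").
Deviations, all within what the source proves: (1) the conclusion records the common supporting
open book (Wendl/Etnyre's Giroux forms, `OpenBook.IsGirouxForm`) rather than the isotopy of
`ξ₊`, `ξ₋` it implies (Giroux) — weaker; (2) `W₂`'s own PALF structure is forgotten; (3) the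
orientation bookkeeping `−X₋` is invisible (`W₂` is an abstract manifold with a Stein structure),
as in the sibling facts `baykur_kahlerDecomposition`, `akbulut_matveyev`; the clause "same
orientation" of the two Giroux forms is what "the same open book on `H = ∂X₊ = −∂X₋`" means for
the two co-oriented contact structures.  The fact is XL (Eliashberg's Legendrian surgery theorem,
Legendrian realisation on convex surfaces, Gay's compatibility theorem, Giroux's correspondence);
its relatives in the tree: `Gompf1998_thm13_twoHandles` (Eliashberg's theorem, named),
`baykur_kahlerDecomposition` (Thm. 5.1 without PALFs, named), and its one contact-topological
input isolated as a named fact, `palf_stein_supportedByBoundaryOpenBook` (PALF ⇒ Stein with the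
boundary contact structure supported by the Kas open book; `LefschetzSteinOpenBook.lean`).

## Review under the fact-decomposition discipline (D-0026/D-0027, 2026-08-17): kept — not dischargeable below `Literature/`; the merge-back is Summit-side

Two discharge seats on this fact (T below) ended `blocked-on:
Literature.Geometry.Symplectic.palf_stein_supportedByBoundaryOpenBook` (S2), and S2 was itself
reviewed the same day and KEPT as an irreducibly XL named fact (record in
`LefschetzSteinOpenBook.lean`: Torisu's base case, the Legendrian realisation principle,
Eliashberg's 2-handle in the strength of Etnyre 2006 Thm. 5.4, Gay 2002 Prop. 2.8 — none of it in
Mathlib or the tree), so T came up for review as a decomposition child with no resolvable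
prerequisite: provable inline, mis-cut (restate / merge back), or not in the source?  Findings, with
the sources open (Baykur 2006, arXiv:math/0601396, §5: Lemma 1, Thm. 5.1 and its proof, pp. 12–14;
Akbulut–Ozbagci 2001, arXiv:math/0012239, proof of the main theorem, p. 8):

* **In the source, faithfully rendered; not an open problem.**  Thm. 5.1 is a theorem of a
  refereed paper (AGT 6 (2006) 1239–1265) and T is the construction of its proof read on the
  tree's fibred models, as audited symbol by symbol at the gate (reviews of p108617 and p109672)
  and summarised in "The Lean rendering" above.  Re-read here: p. 12 *"restrictions of `f` give a
  positive Lefschetz fibration on `X₊ = f⁻¹(D₊)` and a negative Lefschetz fibration on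
  `X₋ = f⁻¹(D₋)`"*; p. 13 *"To recover the original 4-manifold `X` we need to put back in
  `S¹ × D³`, which has the same effect as gluing each other the tubular neighborhoods `S¹ × D₊²`
  and `S¹ × D₋²` of the bindings of open books on `∂X₊` and `∂X₋` … Noting that the NALF on `X₋`
  becomes a PALF on `−X₋`, we see that both PALFs induce the same open book decomposition on
  their boundaries"*; p. 14 *"By [PALF ⇒ Stein], both `X₊` and `−X₋` admit Stein structures … By
  Eliashberg the Stein structure extends over this handle, and as shown by Gay in [Ga], the new
  open book on `∂Xᵢ` will be compatible with the new induced contact structure on `∂Xᵢ`. …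
  Repeating the same argument dually for `−X₋`, we see that the compatible open books on `∂X₊`
  and `∂(−X₋)` are isotopic, and therefore the induced contact structures … are isotopic as
  well"*.  One point checked beyond the earlier audits — the ORIENTATION OF THE SEAM, which
  `ModelsOnFibred` leaves free (it fixes the page angle `arg w` of `Ψ`, not the orientation of `Ψ`
  on the pages): orient `M` by the complex orientation of `X = X(F; P ++ N)`; the cap `Base g`
  then carries `ε ·`(its complex orientation), `ε = −1` exactly when `Ψ` preserves the complex
  page orientations, and in BOTH cases `M ∖ S¹ × D³ → S² = D ∪_{θ∼θ} D'` is an oriented achiral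
  Lefschetz fibration (`D'` carries the conjugate orientation, the cap fibres the orientation
  `−ε ·` complex, consistently with `Ψ` across the seam) whose critical points all lie over `D`,
  positive for the letters of `P` and negative for those of `N` (chirality is read inside `X`:
  page twisting `−1` / `+1`, audit (1) of `LefschetzSteinOpenBook.lean`).  Baykur's splitting
  therefore applies verbatim with `D₊ ⊂ D` a disc around the `P`-values and
  `D₋ = (D ∖ D₊) ∪ D'`: `X₊ = X(F; P) = W₁`, and `X₋ = f⁻¹(D₋) ∪ S¹ × D³ ≅ f⁻¹(D₋)` (the solid
  `S¹ × D³ ≅ S¹ × D₋ × I` is a collar on the binding solid torus) is `W₂ = M ∖ int W₁`, a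
  negative Lefschetz fibration over `D₋`, `−X₋` a PALF.  No orientation hypothesis is missing;
  nothing to restate.  (Degenerate cases, from the gate review: `g = 0` forces `P ++ N = []`; the
  empty word is `M = F × D² ∪ F × D²`; both true and both still need a Stein structure with a
  Giroux form, cf. `isSteinDomain_of_isLefschetzHandlebody_nil` in the Summit file
  `…SteinRealisationTopologicalEnds.lean`, conditional on `IsSteinDomain (Base g)`.)
* **Not provable inline — and not dischargeable in this file at all in the tree's present
  layout.**  The printed proof is (i) the topological splitting above, which over the tree's
  CONCRETE models (`Base g ⊂ ℂ²`, Kosinski multi-attachments, `pageDir`, Kas open books) means: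
  the prefix sub-handlebody is `X(F; P)` after a page-rotating isotopy of its link; the complement
  piece `W₂` and the gluing; the DUAL presentation of `W₂` as a positive allowable Lefschetz
  handlebody over the cap; one seam page function whose open book is the Kas open book of both
  presentations; propagation of the sign of `α ∧ dα` over the connected seam — plus (ii) S2 applied
  to both presentations with that common open book, plus Giroux.  (ii) is XL and kept.  (i) is
  being PROVED, but as SUMMIT theorems of the consuming line (namespace
  `Summit.SmoothPoincare4.SmoothPoincare4.Theorems.AcyclicBisectionExists.ModpBraidOrbits`, files
  `Summits/SmoothPoincare4/SmoothPoincare4/Theorems/ConvexBisectionAcyclicBisectionExists*.lean`,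
  202 of them on 2026-08-17; landed: `…PrefixHandlebody` (T1: `helper_isLefschetzHandlebody_of_split`),
  `…SplitComplement*` (T2), `…KasOpenBook*` (KOB: `helper_kasOpenBook_of_seamFunction`),
  `…ContactSignPropagation` (S3: `helper_wedge_pos_iff_of_exists`), `…SteinRealisationTopologicalEnds`
  (the two ends `N = []`, `P = []` of the sorted word); in progress: the dual-presentation node T3,
  `…DualLink*` (6 files), `…Belt*` (34), `…Page*` (14)), and the ASSEMBLY IS LANDED and sorry-free:
  `steinRealisation_of_nodes` / `helper_steinRealisation_of_nodes :
  (T3 node) → palf_stein_supportedByBoundaryOpenBook → steinRealisation_of_sorted_modelsOnFibred`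
  (`…SteinRealisationReduction.lean`).  Literature may not import Summits
  (`import.summits-from-literature`), so `theorem steinRealisation_of_sorted_modelsOnFibred_holds`
  cannot be written here before BOTH S2 is discharged AND (i) exists below `Literature/`; a
  discharge seat on T can do nothing but park on S2 — which is what happened twice.
* **The cut: kept now; merged back later, on the Summit side.**  While the T3 node is open, T
  asserts strictly more than S2 (Baykur's splitting with matching open books, p. 13, over the
  concrete models) and is consumed BY NAME in three built Summit files —
  `ConvexBisectionSteinBisectionExistsOfLefschetzFacts.lean` (hypothesis `h₃` of the crux's
  conditional theorems), `ConvexBisectionAcyclicBisectionExistsStubSortedModelOf.lean` (fact 5 of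
  the six-fact Lefschetz dictionary), `ConvexBisectionAcyclicBisectionExistsSteinRealisationReduction.lean`
  (conclusion of `helper_steinRealisation_of_nodes`) — and named in the unbuilt design files under
  `Cruxes/AcyclicBisectionExists/`.  So T is neither mis-stated nor, today, a mere re-count.  The
  moment `stub_T3` is proved there, T re-counts S2's debt exactly as `AkbulutMatveyev1998_defectZero`
  re-counted E2's (merged back 2026-08-15, record in `SteinTwoHandles.lean`), and the D-0026-clean
  state is reached Summit-side: the consumers take `helper_steinRealisation_of_nodes hT3 hS2` (the
  same `∀`-text as `h₃`), i.e. the crux's conditional theorems become conditional on S2 alone, after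
  which this `def` has no user and is removed by a whole-file resubmission of this file ("removes
  declarations nothing references" is allowed).  That rewiring edits Summit theorem files of line
  `modp-braid-orbits` (prover / planner seats of stmt-SmoothPoincare4-10508), not Literature, and is
  recorded here for them.  Meanwhile nothing is restated, no Literature copy of the T3 node is
  admissible (it would duplicate the Summit work as new debt), users keep taking
  `(h : steinRealisation_of_sorted_modelsOnFibred)`, and a future Literature-side discharge — if the
  topological half is ever migrated below `Literature/Topology/FourManifolds/` — starts from S2 in
  Etnyre-5.4 strength, as recorded in S2's review.
* **References corrected in this revision** (statement and `[cite]` tag unchanged): Baykur's `[Ga]`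
  is Gay 2002, *Explicit concave fillings of contact three-manifolds*, Math. Proc. Camb. Phil. Soc.
  133 (2002) 431–441, Prop. 2.8 (key `Gay2002`) — the first version listed it under `Gay2006`
  (= *Open books and configurations of symplectic surfaces*, AGT 3 (2003), a different paper);
  Baykur's `[El1]` is Eliashberg, *Topological characterization of Stein manifolds of dimension
  `> 2`*, Internat. J. Math. 1 (1990) (key `Eliashberg1990Stein`; the tree's `Eliashberg1990` is
  *Filling by holomorphic discs*), made explicit in dimension four as Gompf 1998 Thm. 1.3 (tree:
  `Gompf1998_thm13_twoHandles`); the Legendrian realisation principle quoted on p. 14 is Honda 2000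
  Thm. 3.7 / Giroux; Akbulut–Ozbagci's Thm. 5 is the "PALF ⇒ Stein" step (their proof, p. 8:
  *"Conversely, let `X` be a PALF … attaching a 2-handle to a nonseparating curve `C` lying on a
  fiber `F ⊂ ∂X_{i−1}` … with the framing `k − 1` … by the 'Legendrian realization principle' …
  `k` can be taken to be the Thurston–Bennequin framing, and then the result follows by
  Eliashberg's theorem"*).

## References
* R. İ. Baykur, *Kähler decomposition of 4-manifolds*, AGT 6 (2006) 1239–1265, §5: Lemma 1,
  Thm. 5.1, proof pp. 12–14 (arXiv:math/0601396). [Baykur2006]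
* S. Akbulut, B. Ozbagci, *Lefschetz fibrations on compact Stein surfaces*, Geom. Topol. 5 (2001)
  319–334, Thm. 5 and its proof (p. 8 of arXiv:math/0012239). [AkbulutOzbagci2001]
* A. Loi, R. Piergallini, *Compact Stein surfaces with boundary as branched covers of `B⁴`*,
  Invent. Math. 143 (2001) 325–348, Thm. 1. [LoiPiergallini2001]
* D. T. Gay, *Explicit concave fillings of contact three-manifolds*, Math. Proc. Camb. Phil. Soc.
  133 (2002) 431–441, Prop. 2.8 (Baykur's `[Ga]`). [Gay2002]
* Ya. Eliashberg, *Topological characterization of Stein manifolds of dimension `> 2`*, Internat.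
  J. Math. 1 (1990) 29–46 (Baykur's `[El1]`). [Eliashberg1990Stein]
* R. E. Gompf, *Handlebody construction of Stein surfaces*, Ann. of Math. 148 (1998), Thm. 1.3.
  [Gompf1998]
* J. B. Etnyre, *Lectures on open book decompositions and contact structures*, Clay Math. Proc. 5
  (2006), Def. 3.2, Thms. 5.4–5.6. [Etnyre2006]
* K. Honda, *On the classification of tight contact structures I*, Geom. Topol. 4 (2000), Thm. 3.7.
  [Honda2000]
* E. Giroux, *Géométrie de contact: de la dimension trois vers les dimensions supérieures*, ICM
  2002, Vol. II, 405–414. [Giroux2002]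
-/

noncomputable section

open scoped Manifold ContDiff Topology
open Set Function
open Literature.Topology.FourManifolds Literature.Topology.FourManifolds.LefschetzBase

namespace Literature.Geometry.Symplectic

/-- Local notation: `𝔼 n` is the model Euclidean space `EuclideanSpace ℝ (Fin n)`. -/
local notation "𝔼 " n:arg => EuclideanSpace ℝ (Fin n)

/-- **Baykur 2006 (proof of Thm. 5.1, pp. 13–14), with Akbulut–Ozbagci 2001 Thm. 5 / Loi–Piergallini
2001, Eliashberg 1990, Gay, Giroux 2002: Stein realisation of a sorted one-sided Lefschetz model.**
If `M = X(F_{g,1}; P ++ N) ∪_Ψ (F × D²)` (fibred model: `Ψ` page-preserving) with `P` positive, `N`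
negative and all classes non-zero,
then `M = W₁ ∪_φ W₂` with `W₁ = X(F; P)` (`IsLefschetzHandlebody g P W₁`, print's `X₊`) and `W₂`
(print's `−X₋`) compact Stein (`S₁`, `S₂`), and one open book on `∂W₁` supporting, with the same
orientation, both the `S₁`-induced boundary plane field and the `φ`-pull-back of the `S₂`-induced
one (Giroux forms `α₁`, `α₂`).  Hypothesis: a FIBRED model (`ModelsOnFibred`: the seam open books
match, so that the word closes up to the achiral Lefschetz fibration over `S²` that the printed proof
splits).  (Review 2026-08-17, module docstring: in the source, faithfully rendered, true for either
orientation of the seam; not dischargeable below `Literature/` — its proof modulo the kept named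
fact `palf_stein_supportedByBoundaryOpenBook` is the Summit-side `helper_steinRealisation_of_nodes`,
whose topological node is in progress there; kept, to be merged back Summit-side once that node
lands; users take `(h : steinRealisation_of_sorted_modelsOnFibred)`.)
[cite: Baykur2006, Thm. 5.1 (proof, pp. 13–14)] -/
def steinRealisation_of_sorted_modelsOnFibred : Prop :=
  ∀ (M : Type) [TopologicalSpace M] [T2Space M] [SecondCountableTopology M]
    [ChartedSpace (𝔼 4) M] [IsManifold (𝓡 4) ∞ M] (g : ℕ)
    (P N : List ((Fin g ⊕ Fin g → ℤ) × Bool)),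
    ModelsOnFibred M g (P ++ N) → (∀ x ∈ P, x.2 = true) → (∀ x ∈ N, x.2 = false) →
    (∀ x ∈ P ++ N, x.1 ≠ 0) →
    ∃ (W₁ : Type) (_ : TopologicalSpace W₁) (_ : ChartedSpace (EuclideanHalfSpace 4) W₁)
      (_ : IsManifold (𝓡∂ 4) ∞ W₁) (_ : CompactSpace W₁) (_ : T2Space W₁)
      (_ : SecondCountableTopology W₁)
      (W₂ : Type) (_ : TopologicalSpace W₂) (_ : ChartedSpace (EuclideanHalfSpace 4) W₂)
      (_ : IsManifold (𝓡∂ 4) ∞ W₂) (_ : CompactSpace W₂)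
      (S₁ : SteinStructure W₁) (S₂ : SteinStructure W₂)
      (b₁ : BoundaryData (𝓡∂ 4) W₁ (𝓡 3)) (b₂ : BoundaryData (𝓡∂ 4) W₂ (𝓡 3))
      (φ : b₁.carrier ≃ₘ⟮𝓡 3, 𝓡 3⟯ b₂.carrier)
      (ob : OpenBook b₁.carrier)
      (α₁ α₂ : Literature.Geometry.Kaehler.MForm (𝓡 3) b₁.carrier ℝ 1),
      IsBoundaryGluing b₁ b₂ φ (𝓡 4) M ∧
      ob.IsGirouxForm (boundaryPlaneField S₁.J b₁) α₁ ∧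
      ob.IsGirouxForm (fun y => (boundaryPlaneField S₂.J b₂ (φ y)).comap
        (mfderiv (𝓡 3) (𝓡 3) φ y).toLinearMap) α₂ ∧
      (∀ y u v w, 0 < wedge₁₂ (α₁ y) (Literature.Geometry.Kaehler.mextDeriv α₁ y) u v w ↔
        0 < wedge₁₂ (α₂ y) (Literature.Geometry.Kaehler.mextDeriv α₂ y) u v w) ∧
      IsLefschetzHandlebody g P W₁

end Literature.Geometry.Symplectic
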